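import Summits.CriticalPhenomena.PercolationContinuityZ3.Theorems.PercNearOneGluingNoHeavyLowerTailThreePartitionGridMatching
import Summits.CriticalPhenomena.PercolationContinuityZ3.Theorems.PercNearOneGluingNoHeavyLowerTailThreePartitionGridFibrePairing
import Summits.CriticalPhenomena.PercolationContinuityZ3.Theorems.PercNearOneGluingNoHeavyLowerTailThreePartitionGridHall
import HarnessLib.Audit

/-!
# `NoHeavyLowerTail` (crux stmt-CriticalPhenomena-4575), master-family hierarchy P3 (gen 34): the TYPED fibre-local token matching
# EXISTS for `𝒱 = ⊤`, every up-set `𝒲`, every twist `τ` — `TypedMatchable τ Set.univ 𝒲` — by Kleitman's strict pairing and mirror exits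

Support file (seat `prim-masterthm-p3`; `--supports stmt-CriticalPhenomena-4575`; memo
`run/shared/lean/prim/prim-masterthm/FROM-prim-masterthm-p3-g34-FIBRE-LOCAL-CERTIFICATE.md` §8, HIERARCHY §41).  Companion of
`…ThreePartitionGridMatching` (tokens, `typedEdge`, `TypedMatchable`, conjecture `TypedGridMatching`).  `𝒱 = ⊤` is the V-RED terminal
representative of every nested pair `𝒲 ⊆ 𝒱` (memo §1); the typed matching was known only for `𝒲` principal, `τ = ∅` (memo §5d).
CONSTRUCTION (memo §8b).  `N1` tokens with `x₁ ∈ 𝒲`, all `N2` tokens, and `N3` tokens with `x₃ ∈ 𝒲` take their own unit `a` / `b` / `T₂`.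
A 'bad' `N1` token `{x₁∉𝒲, x₃∈𝒲}` keeps its second PART `S₂`; then `x₁` runs over the folding fibre `(S₂ᶜ, τ∩S₂)` of
`Literature.Probability.Percolation.FoldingFibre` and `x₃ = x₁ ∆ S₂ᶜ` is its reflection, so the bad tokens and the 'sites' `{x₁∈𝒲, x₃∉𝒲}`
of the fibre are `σ𝒲∖𝒲` and `𝒲∖σ𝒲`, matched bijectively and increasingly by Hall's theorem and the fibrewise Harris inequality
(`FoldingFibre.fibreCount_le_of_isUpperSet`): **`exists_fibre_pairing`**; the token lands on unit `a` of its site (same `x₂`, larger `x₁`).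
Every remaining `N3` token `{x₂∈𝒲, x₃∉𝒲}` is the mirror `ρd` (swap parts 1, 2) of a site `d` and exits to the `T₂` token at the mirror `ρc` of
the bad token `c` landing on `d` (`x₁(ρd) = x₁(ρc)`, `x₂(ρc) = x₁(c) ⊆ x₁(d) = x₂(ρd)`).  **`typedMatchable_univ`**: the first class of
`TypedGridMatching` in the kernel, and the mechanism 'land by a pure merge, exit by the mirror' in closed form.
HONEST LABEL: one class of an open conjecture (`TypedGridMatching` ⟹ `GridTransport` ⟹ COMB-C3 ⟹ Sahi's `C₃`); nothing here bears on the
crux. [this work]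
-/

noncomputable section

open Finset
open scoped symmDiff Classical

namespace Summit.CriticalPhenomena.PercolationContinuityZ3.Theorems.ThreePartition

variable {ι : Type*} [Fintype ι]

/-! ## The typed matching for `𝒱 = ⊤` -/

/-- **`TypedMatchable τ ⊤ 𝒲` for every up-set `𝒲` and every twist `τ`** (memo §8b): pointwise cancellations, Kleitman's strict
pairing on each x₂-fibre for the bad `N1` tokens (`exists_fibre_pairing`), and mirror exits for the remaining `N3` tokens.
[this work] -/
theorem typedMatchable_univ (τ : Set ι) {𝒲 : Set (Set ι)} (h𝒲 : IsUpperSet 𝒲) :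
    TypedMatchable τ (Set.univ : Set (Set ι)) 𝒲 := by
  -- the bad points / sites of the x₂-fibre with second part `S`
  obtain ⟨Bad, hBad⟩ : ∃ Bad : Set ι → Set (Set ι), ∀ S a, a ∈ Bad S ↔ a \ Sᶜ = τ ∩ S ∧ a ∉ 𝒲 ∧ a ∆ Sᶜ ∈ 𝒲 :=
    ⟨fun S => {a | a \ Sᶜ = τ ∩ S ∧ a ∉ 𝒲 ∧ a ∆ Sᶜ ∈ 𝒲}, fun _ _ => Iff.rfl⟩
  obtain ⟨Site, hSite⟩ : ∃ Site : Set ι → Set (Set ι), ∀ S b, b ∈ Site S ↔ b \ Sᶜ = τ ∩ S ∧ b ∈ 𝒲 ∧ b ∆ Sᶜ ∉ 𝒲 :=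
    ⟨fun S => {b | b \ Sᶜ = τ ∩ S ∧ b ∈ 𝒲 ∧ b ∆ Sᶜ ∉ 𝒲}, fun _ _ => Iff.rfl⟩
  -- one strict Kleitman pairing per fibre
  have hpair : ∀ S : Set ι, ∃ g : Set ι → Set ι, Set.BijOn g (Bad S) (Site S) ∧
      ∀ a : Set ι, a \ Sᶜ = τ ∩ S → a ∉ 𝒲 → a ∆ Sᶜ ∈ 𝒲 → a ⊆ g a := by
    intro S
    obtain ⟨g, hg, hsub⟩ := exists_fibre_pairing h𝒲 Sᶜ (τ ∩ S)
    refine ⟨g, ?_, hsub⟩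
    have e1 : (↑(univ.filter fun a : Set ι => a \ Sᶜ = τ ∩ S ∧ a ∉ 𝒲 ∧ a ∆ Sᶜ ∈ 𝒲) : Set (Set ι)) = Bad S := by
      ext a; rw [mem_coe, mem_filter, hBad]; simp only [mem_univ, true_and]
    have e2 : (↑(univ.filter fun b : Set ι => b \ Sᶜ = τ ∩ S ∧ b ∈ 𝒲 ∧ b ∆ Sᶜ ∉ 𝒲) : Set (Set ι)) = Site S := by
      ext b; rw [mem_coe, mem_filter, hSite]; simp only [mem_univ, true_and]
    rw [e1, e2] at hg
    exact hg
  choose g hg using hpair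
  have hne : Nonempty (Set ι) := ⟨∅⟩
  -- the inverse pairings
  obtain ⟨gi, hgi⟩ : ∃ gi : Set ι → Set ι → Set ι, ∀ S, Set.InvOn (gi S) (g S) (Bad S) (Site S) ∧
      Set.MapsTo (gi S) (Site S) (Bad S) :=
    ⟨fun S => Function.invFunOn (g S) (Bad S), fun S => ⟨(hg S).1.invOn_invFunOn, (hg S).1.surjOn.mapsTo_invFunOn⟩⟩
  -- the matching
  let Φ : (Set ι × Set ι) × Fin 3 → (Set ι × Set ι) × Fin 3 := fun t =>
    if t.2 = 1 then t
    else if t.2 = 0 then (if cp₁ τ t.1 ∈ 𝒲 then t else ((((g t.1.2 (cp₁ τ t.1)) ∆ τ) \ t.1.2, t.1.2), 0))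
    else (if cp₃ τ t.1 ∈ 𝒲 then t else ((t.1.1, ((gi t.1.1 (cp₂ τ t.1)) ∆ τ) \ t.1.1), 2))
  have Φ1 : ∀ q, Φ (q, 1) = (q, 1) := fun q => rfl
  have Φ0 : ∀ q, Φ (q, 0) = if cp₁ τ q ∈ 𝒲 then (q, 0) else ((((g q.2 (cp₁ τ q)) ∆ τ) \ q.2, q.2), 0) := fun q => by
    simp only [Φ, if_true]
    rw [if_neg (show ¬ ((0 : Fin 3) = 1) by decide)]
  have Φ2 : ∀ q, Φ (q, 2) = if cp₃ τ q ∈ 𝒲 then (q, 2) else ((q.1, ((gi q.1 (cp₂ τ q)) ∆ τ) \ q.1), 2) := fun q => by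
    simp only [Φ]
    rw [if_neg (show ¬ ((2 : Fin 3) = 1) by decide), if_neg (show ¬ ((2 : Fin 3) = 0) by decide)]
  -- bookkeeping: membership in the token sets
  have hneg : ∀ q i, (q, i) ∈ negToks τ (Set.univ : Set (Set ι)) 𝒲 ↔ Disjoint q.1 q.2 ∧ negCond τ Set.univ 𝒲 q i := by
    intro q i
    simp only [negToks, cfgs, mem_filter, mem_product, mem_univ, and_true, true_and]
  have hpos : ∀ q j, (q, j) ∈ posToks τ (Set.univ : Set (Set ι)) 𝒲 ↔ Disjoint q.1 q.2 ∧ posCond τ Set.univ 𝒲 q j := by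
    intro q j
    simp only [posToks, cfgs, mem_filter, mem_product, mem_univ, and_true, true_and]
  have nc0 : ∀ q, negCond τ (Set.univ : Set (Set ι)) 𝒲 q 0 ↔ cp₃ τ q ∈ 𝒲 := fun q => by simp [negCond]
  have nc1 : ∀ q, negCond τ (Set.univ : Set (Set ι)) 𝒲 q 1 ↔ cp₁ τ q ∈ 𝒲 := fun q => by simp [negCond]
  have nc2 : ∀ q, negCond τ (Set.univ : Set (Set ι)) 𝒲 q 2 ↔ cp₂ τ q ∈ 𝒲 := fun q => by simp [negCond]
  have pc0 : ∀ q, posCond τ (Set.univ : Set (Set ι)) 𝒲 q 0 ↔ cp₁ τ q ∈ 𝒲 := fun q => by simp [posCond]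
  have pc1 : ∀ q, posCond τ (Set.univ : Set (Set ι)) 𝒲 q 1 ↔ cp₁ τ q ∈ 𝒲 := fun q => by simp [posCond]
  have pc2 : ∀ q, posCond τ (Set.univ : Set (Set ι)) 𝒲 q 2 ↔ cp₃ τ q ∈ 𝒲 := fun q => by simp [posCond]
  -- the bad point of an `N1` token and the site mirror to an `N3` token
  have badN1 : ∀ q : Set ι × Set ι, Disjoint q.1 q.2 → cp₃ τ q ∈ 𝒲 → cp₁ τ q ∉ 𝒲 → cp₁ τ q ∈ Bad q.2 := by
    intro q hq h3 h1
    rw [hBad]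
    exact ⟨cp₁_sdiff_compl_snd τ hq, h1, by rwa [← cp₃_eq_cp₁_symmDiff τ hq]⟩
  have siteN3 : ∀ q : Set ι × Set ι, Disjoint q.1 q.2 → cp₂ τ q ∈ 𝒲 → cp₃ τ q ∉ 𝒲 → cp₂ τ q ∈ Site q.1 := by
    intro q hq h2 h3
    rw [hSite]
    exact ⟨cp₂_sdiff_compl_fst τ hq, h2, by rwa [← cp₃_eq_cp₂_symmDiff τ hq]⟩
  refine ⟨Φ, ?_, ?_⟩
  · -- every negative token goes to an admissible positive token
    rintro ⟨q, i⟩ ht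
    obtain ⟨hq, hn⟩ := (hneg q i).1 ht
    fin_cases i
    · -- N1
      simp only [Fin.zero_eta, Fin.isValue] at hn ⊢
      rw [nc0] at hn
      rw [Φ0]
      by_cases h1 : cp₁ τ q ∈ 𝒲
      · rw [if_pos h1]
        exact ⟨(hpos q 0).2 ⟨hq, (pc0 q).2 h1⟩, gle_refl τ q, Or.inl ⟨rfl, Or.inl ⟨rfl, rfl⟩⟩⟩
      · rw [if_neg h1]
        have ha := badN1 q hq hn h1
        have hb : g q.2 (cp₁ τ q) ∈ Site q.2 := (hg q.2).1.mapsTo ha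
        rw [hBad] at ha
        rw [hSite] at hb
        have hab : cp₁ τ q ⊆ g q.2 (cp₁ τ q) := (hg q.2).2 _ ha.1 ha.2.1 ha.2.2
        have hd : Disjoint (((g q.2 (cp₁ τ q)) ∆ τ) \ q.2) q.2 := Set.disjoint_sdiff_left
        have hc1 : cp₁ τ ((((g q.2 (cp₁ τ q)) ∆ τ) \ q.2, q.2)) = g q.2 (cp₁ τ q) :=
          symmDiff_sdiff_symmDiff_of_fibre τ hb.1
        refine ⟨(hpos _ 0).2 ⟨hd, (pc0 _).2 (by rw [hc1]; exact hb.2.1)⟩, ⟨?_, ?_⟩, Or.inl ⟨rfl, Or.inl ⟨rfl, rfl⟩⟩⟩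
        · show cp₁ τ q ⊆ cp₁ τ ((((g q.2 (cp₁ τ q)) ∆ τ) \ q.2, q.2))
          rw [hc1]; exact hab
        · exact subset_rfl
    · -- N2
      simp only [Fin.mk_one, Fin.isValue] at hn ⊢
      rw [nc1] at hn
      rw [Φ1]
      exact ⟨(hpos q 1).2 ⟨hq, (pc1 q).2 hn⟩, gle_refl τ q, Or.inr (Or.inl ⟨rfl, rfl, rfl⟩)⟩
    · -- N3
      simp only [Fin.reduceFinMk, Fin.isValue] at hn ⊢
      rw [nc2] at hn
      rw [Φ2]
      by_cases h3 : cp₃ τ q ∈ 𝒲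
      · rw [if_pos h3]
        exact ⟨(hpos q 2).2 ⟨hq, (pc2 q).2 h3⟩, gle_refl τ q, Or.inr (Or.inr ⟨rfl, Or.inr ⟨rfl, rfl⟩⟩)⟩
      · rw [if_neg h3]
        have hb := siteN3 q hq hn h3
        have ha : gi q.1 (cp₂ τ q) ∈ Bad q.1 := (hgi q.1).2 hb
        have hgab : g q.1 (gi q.1 (cp₂ τ q)) = cp₂ τ q := (hgi q.1).1.2 hb
        rw [hBad] at ha
        have hab : gi q.1 (cp₂ τ q) ⊆ cp₂ τ q := by
          have h := (hg q.1).2 _ ha.1 ha.2.1 ha.2.2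
          rwa [hgab] at h
        have hd : Disjoint q.1 (((gi q.1 (cp₂ τ q)) ∆ τ) \ q.1) := Set.disjoint_sdiff_right
        have hc2 : cp₂ τ ((q.1, ((gi q.1 (cp₂ τ q)) ∆ τ) \ q.1)) = gi q.1 (cp₂ τ q) :=
          symmDiff_sdiff_symmDiff_of_fibre τ ha.1
        have hc3 : cp₃ τ ((q.1, ((gi q.1 (cp₂ τ q)) ∆ τ) \ q.1)) = gi q.1 (cp₂ τ q) ∆ q.1ᶜ := cp₃_mk_snd τ ha.1
        refine ⟨(hpos _ 2).2 ⟨hd, (pc2 _).2 (by rw [hc3]; exact ha.2.2)⟩, ⟨subset_rfl, ?_⟩,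
          Or.inr (Or.inr ⟨rfl, Or.inr ⟨rfl, rfl⟩⟩)⟩
        show cp₂ τ ((q.1, ((gi q.1 (cp₂ τ q)) ∆ τ) \ q.1)) ⊆ cp₂ τ q
        rw [hc2]; exact hab
  · -- injectivity
    rintro ⟨q, i⟩ ht ⟨q', i'⟩ ht' hΦ
    obtain ⟨hq, hn⟩ := (hneg q i).1 ht
    obtain ⟨hq', hn'⟩ := (hneg q' i').1 ht'
    -- the type is preserved, so `i = i'`
    have htype : ∀ (p : Set ι × Set ι) (k : Fin 3), (Φ (p, k)).2 = k := by
      intro p k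
      fin_cases k
      · simp only [Fin.zero_eta, Fin.isValue]; rw [Φ0]; split_ifs <;> rfl
      · simp only [Fin.mk_one, Fin.isValue]; rw [Φ1]
      · simp only [Fin.reduceFinMk, Fin.isValue]; rw [Φ2]; split_ifs <;> rfl
    have hii : i = i' := by
      have h := congrArg Prod.snd hΦ
      rwa [htype, htype] at h
    subst hii
    fin_cases i
    · -- N1
      simp only [Fin.zero_eta, Fin.isValue] at hn hn' hΦ ⊢
      rw [nc0] at hn hn'
      rw [Φ0, Φ0] at hΦ
      -- a landed image has copy 3 outside `𝒲`, a self image inside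
      have hland : ∀ p : Set ι × Set ι, Disjoint p.1 p.2 → cp₃ τ p ∈ 𝒲 → cp₁ τ p ∉ 𝒲 →
          cp₃ τ ((((g p.2 (cp₁ τ p)) ∆ τ) \ p.2, p.2)) ∉ 𝒲 ∧
          cp₁ τ ((((g p.2 (cp₁ τ p)) ∆ τ) \ p.2, p.2)) = g p.2 (cp₁ τ p) := by
        intro p hp h3 h1
        have hb : g p.2 (cp₁ τ p) ∈ Site p.2 := (hg p.2).1.mapsTo (badN1 p hp h3 h1)
        rw [hSite] at hb
        exact ⟨by rw [cp₃_mk_fst τ hb.1]; exact hb.2.2, symmDiff_sdiff_symmDiff_of_fibre τ hb.1⟩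
      by_cases h1 : cp₁ τ q ∈ 𝒲 <;> by_cases h1' : cp₁ τ q' ∈ 𝒲
      · rw [if_pos h1, if_pos h1'] at hΦ
        exact hΦ
      · rw [if_pos h1, if_neg h1'] at hΦ
        have h := (hland q' hq' hn' h1').1
        have e : q = ((((g q'.2 (cp₁ τ q')) ∆ τ) \ q'.2, q'.2) : Set ι × Set ι) := congrArg Prod.fst hΦ
        rw [← e] at h
        exact absurd hn h
      · rw [if_neg h1, if_pos h1'] at hΦ
        have h := (hland q hq hn h1).1
        have e : ((((g q.2 (cp₁ τ q)) ∆ τ) \ q.2, q.2) : Set ι × Set ι) = q' := congrArg Prod.fst hΦ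
        rw [e] at h
        exact absurd hn' h
      · rw [if_neg h1, if_neg h1'] at hΦ
        have hcfg : ((((g q.2 (cp₁ τ q)) ∆ τ) \ q.2, q.2) : Set ι × Set ι)
            = (((g q'.2 (cp₁ τ q')) ∆ τ) \ q'.2, q'.2) := congrArg Prod.fst hΦ
        have hS : q.2 = q'.2 := (Prod.mk.inj hcfg).2
        have hgg : g q.2 (cp₁ τ q) = g q.2 (cp₁ τ q') := by
          rw [← (hland q hq hn h1).2, hcfg, (hland q' hq' hn' h1').2, hS]
        have ha := badN1 q hq hn h1
        have ha' := badN1 q' hq' hn' h1'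
        rw [← hS] at ha'
        have h11 : cp₁ τ q = cp₁ τ q' := (hg q.2).1.injOn ha ha' hgg
        have hfst : q.1 = q'.1 := by
          have h := congrArg (fun s => s ∆ τ) h11
          simpa only [cp₁, symmDiff_symmDiff_cancel_right] using h
        rw [Prod.ext hfst hS]
    · -- N2
      simp only [Fin.mk_one, Fin.isValue] at hΦ ⊢
      rw [Φ1, Φ1] at hΦ
      exact hΦ
    · -- N3
      simp only [Fin.reduceFinMk, Fin.isValue] at hn hn' hΦ ⊢
      rw [nc2] at hn hn'
      rw [Φ2, Φ2] at hΦ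
      -- an exit image has copy 2 outside `𝒲`, a self image inside
      have hexit : ∀ p : Set ι × Set ι, Disjoint p.1 p.2 → cp₂ τ p ∈ 𝒲 → cp₃ τ p ∉ 𝒲 →
          cp₂ τ ((p.1, ((gi p.1 (cp₂ τ p)) ∆ τ) \ p.1)) ∉ 𝒲 ∧
          cp₂ τ ((p.1, ((gi p.1 (cp₂ τ p)) ∆ τ) \ p.1)) = gi p.1 (cp₂ τ p) ∧
          g p.1 (gi p.1 (cp₂ τ p)) = cp₂ τ p := by
        intro p hp h2 h3
        have hb := siteN3 p hp h2 h3
        have ha : gi p.1 (cp₂ τ p) ∈ Bad p.1 := (hgi p.1).2 hb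
        have hgab : g p.1 (gi p.1 (cp₂ τ p)) = cp₂ τ p := (hgi p.1).1.2 hb
        rw [hBad] at ha
        have hc2 : cp₂ τ ((p.1, ((gi p.1 (cp₂ τ p)) ∆ τ) \ p.1)) = gi p.1 (cp₂ τ p) :=
          symmDiff_sdiff_symmDiff_of_fibre τ ha.1
        exact ⟨by rw [hc2]; exact ha.2.1, hc2, hgab⟩
      by_cases h3 : cp₃ τ q ∈ 𝒲 <;> by_cases h3' : cp₃ τ q' ∈ 𝒲
      · rw [if_pos h3, if_pos h3'] at hΦ
        exact hΦ
      · rw [if_pos h3, if_neg h3'] at hΦ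
        have h := (hexit q' hq' hn' h3').1
        have e : q = ((q'.1, ((gi q'.1 (cp₂ τ q')) ∆ τ) \ q'.1) : Set ι × Set ι) := congrArg Prod.fst hΦ
        rw [← e] at h
        exact absurd hn h
      · rw [if_neg h3, if_pos h3'] at hΦ
        have h := (hexit q hq hn h3).1
        have e : ((q.1, ((gi q.1 (cp₂ τ q)) ∆ τ) \ q.1) : Set ι × Set ι) = q' := congrArg Prod.fst hΦ
        rw [e] at h
        exact absurd hn' h
      · rw [if_neg h3, if_neg h3'] at hΦ
        have hcfg : ((q.1, ((gi q.1 (cp₂ τ q)) ∆ τ) \ q.1) : Set ι × Set ι) = (q'.1, ((gi q'.1 (cp₂ τ q')) ∆ τ) \ q'.1) :=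
          congrArg Prod.fst hΦ
        have hS : q.1 = q'.1 := (Prod.mk.inj hcfg).1
        obtain ⟨-, e2, e3⟩ := hexit q hq hn h3
        obtain ⟨-, e2', e3'⟩ := hexit q' hq' hn' h3'
        have haa : gi q.1 (cp₂ τ q) = gi q'.1 (cp₂ τ q') := by rw [← e2, hcfg, e2']
        have h22 : cp₂ τ q = cp₂ τ q' := by rw [← e3, haa, hS, e3']
        have hsnd : q.2 = q'.2 := by
          have h := congrArg (fun s => s ∆ τ) h22
          simpa only [cp₂, symmDiff_symmDiff_cancel_right] using h
        rw [Prod.ext hS hsnd]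

/-- Hence a (plain) token matching for `𝒱 = ⊤`: `GTMatchable τ ⊤ 𝒲`. [this work] -/
theorem gtMatchable_univ (τ : Set ι) {𝒲 : Set (Set ι)} (h𝒲 : IsUpperSet 𝒲) : GTMatchable τ (Set.univ : Set (Set ι)) 𝒲 :=
  gtMatchable_of_typedMatchable (typedMatchable_univ τ h𝒲)

end Summit.CriticalPhenomena.PercolationContinuityZ3.Theorems.ThreePartition

end
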